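import Literature.NumberTheory.DiophantineGeometry.GenEllTorsionFieldBaseChange
import Literature.NumberTheory.EllipticCurves.DivisionField
import HarnessLib

/-!
# [GenEll] Thm 3.8, proof: over an ABSTRACT `K ⊇ L(E[n])` (given with an embedding `K → L̄`) the
# `n`-torsion of `E ⊗_L K` is Galois-fixed — transport to the algebraic closure of `K`

S. Mochizuki, *Arithmetic elliptic curves in general position*, Math. J. Okayama Univ. **52** (2010)
[cite: MochizukiGenEll2010], proof of Theorem 3.8, p. 20 («there exists a Galois extension `L′` of
`L` … so as to render the `3`- and `5`-torsion points of `E_L` rational over `L′` … `E_{L′} :=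
E_L ×_L L′`»); J. H. Silverman, *The Arithmetic of Elliptic Curves*, VIII.§1 (the action of
`G_{K̄/K}` on `E[m]`; the field `K(E[m])`).

Proof-only sequel of `GenEllTorsionFieldBaseChange` (`EllPoint.forall_smul_geomTorsion_map_eq_of_
fixingSubgroup_le`, which serves INTERMEDIATE FIELDS `L′ ⊆ L̄ = AlgebraicClosure L` only).  Consumers
in the tree present the extension field as an ABSTRACT field `K` with an `L`-algebra structure and an
`L`-embedding `ψ : K →ₐ[L] L̄` (e.g. `K` a number field carrying its own instances), and express
"`K ⊇ L(E[n])`" in `Γ_L`-currency as `ψ.fieldRange.fixingSubgroup ≤ ker ρ̄_{E,n}` (every element of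
`Γ_L` fixing `ψ(K)` pointwise acts trivially on `E[n](L̄)`).  PROVED here, for any Weierstrass curve
`W` over any field `L`:

* `WeierstrassCurve.forall_smul_geomTorsion_map_eq_of_fieldRange_fixingSubgroup_le` — under that
  hypothesis every element of `Γ_K = Gal(K̄/K)` (`K̄ = AlgebraicClosure K`, a DIFFERENT algebraic
  closure) fixes every point of `(W ⊗_L K)[n](K̄)`.  Transport along a `K`-isomorphism
  `ι : L̄ ≃ K̄` (`L̄` is an algebraic closure of `K` through `ψ`; Mathlib `IsAlgClosure.equiv`):
  `σ′ ↦ ι⁻¹σ′ι` is `K`-linear on `L̄`, hence lies in `ψ(K)`'s fixing group `≤ ker ρ̄_{E,n}`.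
* `WeierstrassCurve.fixingSubgroup_divisionField_eq_ker` — for `E` elliptic over a field of
  characteristic `0` and `n ≠ 0`, the fixing group of THE division field `L(E[n]) ⊆ L̄` (the tree's
  `WeierstrassCurve.divisionField`) IS `ker ρ̄_{E,n}`; hence (`…_of_fieldRange_eq_divisionField`) an
  abstract `K` with `ψ.fieldRange = L(E[n])` satisfies both containments, and `Γ_K` fixes
  `(W ⊗_L K)[n](K̄)`.

Proof-only; no definitions, no instances.
-/

noncomputable section

open scoped Classical

universe u v

namespace WeierstrassCurve

open Literature.NumberTheory.EllipticCurves Literature.NumberTheory.GaloisRepresentations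

variable {L : Type u} [Field L] (W : WeierstrassCurve L) (n : ℕ)
variable {K : Type v} [Field K] [Algebra L K] (ψ : K →ₐ[L] AlgebraicClosure L)

set_option maxHeartbeats 400000 in
/-- **`E[n]` is rational over any `K ⊇ L(E[n])` given abstractly with an `L`-embedding `ψ : K → L̄`,
in the algebraic closure of `K`**: if every element of `Γ_L` fixing `ψ(K)` pointwise acts trivially
on `E[n](L̄)` (`ψ.fieldRange.fixingSubgroup ≤ ker ρ̄_{E,n}`, i.e. `ψ(K) ⊇ L(E[n])`), then every
element of `Gal(K̄/K)` fixes every `n`-torsion point of `W ⊗_L K` over `K̄ = AlgebraicClosure K`.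
(Transport along a `K`-isomorphism `L̄ ≃ K̄`, `L̄` being an algebraic closure of `K` via `ψ`:
`σ′ ↦ ι⁻¹σ′ι` is `K`-linear, so fixes `ψ(K)`, so lies in `ker ρ̄_{E,n}`.)  The abstract-field form of
`EllPoint.forall_smul_geomTorsion_map_eq_of_fixingSubgroup_le`.
[cite: MochizukiGenEll2010, Thm 3.8 p.20] [cite: SilvermanAEC2009, VIII.§1] -/
theorem forall_smul_geomTorsion_map_eq_of_fieldRange_fixingSubgroup_le
    (hK : ψ.fieldRange.fixingSubgroup ≤ (W.galoisRepTorsion (n : ℤ)).ker) :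
    ∀ (σ' : Field.absoluteGaloisGroup K)
      (Q : (W.map (algebraMap L K)).geomTorsion (n : ℤ)), σ' • Q = Q := by
  -- the two algebraic closures; `Ω = L̄` is an algebraic closure of `K` through `ψ`
  let Ω := AlgebraicClosure L
  let K' := AlgebraicClosure K
  letI : Algebra K Ω := ψ.toRingHom.toAlgebra
  haveI : IsScalarTower L K Ω := IsScalarTower.of_algebraMap_eq fun x => (ψ.commutes x).symm
  haveI : Algebra.IsAlgebraic K Ω := Algebra.IsAlgebraic.tower_top (K := L) K
  haveI : IsAlgClosure K Ω :=
    { isAlgClosed := inferInstanceAs (IsAlgClosed (AlgebraicClosure L))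
      isAlgebraic := inferInstance }
  let ι : Ω ≃ₐ[K] K' := IsAlgClosure.equiv K Ω K'
  let ιL : Ω ≃ₐ[L] K' := ι.restrictScalars L
  let W' : WeierstrassCurve K := W.map (algebraMap L K)
  -- transport of geometric points along `ι` and `ι⁻¹`
  let T : W.geomPoints →+ W'.geomPoints :=
    Affine.Point.map (W' := W) (ιL : Ω →ₐ[L] K')
  let Ti : W'.geomPoints →+ W.geomPoints :=
    Affine.Point.map (W' := W) (ιL.symm : K' →ₐ[L] Ω)
  have hmap_id' : ∀ y : W'.geomPoints, Affine.Point.map (W' := W) (AlgHom.id L K') y = y :=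
    fun y => by cases y <;> rfl
  have hTTi : ∀ y, T (Ti y) = y := fun y => by
    change Affine.Point.map (W' := W) (ιL : Ω →ₐ[L] K')
      (Affine.Point.map (W' := W) (ιL.symm : K' →ₐ[L] Ω) y) = y
    rw [Affine.Point.map_map, AlgEquiv.comp_symm, hmap_id']
  -- the torsion point `Q′` comes from a torsion point `Q` over `Ω`
  intro σ' Q'
  have hQmem : Ti (Q' : W'.geomPoints) ∈ W.geomTorsion (n : ℤ) := by
    have hy := (Submodule.mem_torsionBy_iff (n : ℤ) (Q' : W'.geomPoints)).mp Q'.2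
    refine (Submodule.mem_torsionBy_iff (n : ℤ) _).mpr ?_
    change (n : ℤ) • Ti (Q' : W'.geomPoints) = 0
    rw [← map_zsmul, show (n : ℤ) • (Q' : W'.geomPoints) = 0 from hy, map_zero]
  set Q : W.geomTorsion (n : ℤ) := ⟨Ti (Q' : W'.geomPoints), hQmem⟩ with hQ
  have hTQ : T (Q : W.geomPoints) = (Q' : W'.geomPoints) := hTTi _
  -- pull `σ′` back along `ι`: a `K`-linear automorphism of `Ω`, fixing `ψ(K)`, hence in `ker ρ̄`
  let τ : K' ≃ₐ[K] K' := (show K' ≃ₐ[K] K' from σ')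
  let σe : Ω ≃ₐ[K] Ω := ι.trans (τ.trans ι.symm)
  let σ : Field.absoluteGaloisGroup L := σe.restrictScalars L
  have hσfix : σ ∈ (ψ.fieldRange.fixingSubgroup : Subgroup (Field.absoluteGaloisGroup L)) := by
    change (σe.restrictScalars L : Ω ≃ₐ[L] Ω) ∈ ψ.fieldRange.fixingSubgroup
    rw [IntermediateField.mem_fixingSubgroup_iff]
    rintro _ ⟨x, rfl⟩
    exact σe.commutes x
  have hker : W.galoisRepTorsion (n : ℤ) σ = 1 := hK hσfix
  have hσQ : σ • Q = Q := by
    have h := galoisRepTorsion_apply W (n : ℤ) σ Q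
    rw [hker] at h
    exact h.symm
  -- the action of `σ′` on `T Q` is the transport of the action of `σ` on `Q`
  have hactP' : ∀ (y : W'.geomPoints), σ' • y =
      Affine.Point.map (W' := W) ((τ.restrictScalars L : K' ≃ₐ[L] K') : K' →ₐ[L] K') y :=
    fun y => by cases y <;> rfl
  have hcomp : (ιL : Ω →ₐ[L] K').comp ((σe.restrictScalars L : Ω ≃ₐ[L] Ω) : Ω →ₐ[L] Ω) =
      ((τ.restrictScalars L : K' ≃ₐ[L] K') : K' →ₐ[L] K').comp (ιL : Ω →ₐ[L] K') := by
    ext z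
    change ι (ι.symm (τ (ι z))) = τ (ι z)
    rw [AlgEquiv.apply_symm_apply]
  have key : T ((σ • Q : W.geomTorsion (n : ℤ)) : W.geomPoints) = σ' • T (Q : W.geomPoints) := by
    rw [hactP']
    change Affine.Point.map (W' := W) (ιL : Ω →ₐ[L] K')
        (Affine.Point.map (W' := W) ((σe.restrictScalars L : Ω ≃ₐ[L] Ω) : Ω →ₐ[L] Ω)
          (Q : W.geomPoints)) =
      Affine.Point.map (W' := W) ((τ.restrictScalars L : K' ≃ₐ[L] K') : K' →ₐ[L] K')
        (Affine.Point.map (W' := W) (ιL : Ω →ₐ[L] K') (Q : W.geomPoints))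
    rw [Affine.Point.map_map, Affine.Point.map_map, hcomp]
  -- conclude
  apply Subtype.ext
  rw [AddSubgroup.torsionBy.coe_smul, ← hTQ, ← key, hσQ]

/-- **The fixing group of `L(E[n])` is `ker ρ̄_{E,n}`** (`E` elliptic, `n ≠ 0`, `char L = 0`): the
pointwise fixer of THE division field `L(E[n]) ⊆ L̄` in `Γ_L` (`fixingSubgroup_divisionField`: the
pointwise stabiliser of `E[n](L̄)`) coincides with the kernel of the mod-`n` representation
(`coe_ker_galoisRepTorsion`: the pointwise stabiliser too; over a number field the tree's
`ker_galoisRepTorsion_le_fixingSubgroup_divisionField` is the inclusion `≥`).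
[cite: SilvermanAEC2009, VIII.§1] -/
theorem fixingSubgroup_divisionField_eq_ker [CharZero L] [W.IsElliptic] [NeZero n] :
    ((W.divisionField n).fixingSubgroup : Subgroup (Field.absoluteGaloisGroup L)) =
      (W.galoisRepTorsion (n : ℤ)).ker := by
  rw [W.fixingSubgroup_divisionField n]
  ext σ
  rw [W.mem_fixingSubgroupOfModule_geomTorsion_iff n, ← SetLike.mem_coe, coe_ker_galoisRepTorsion,
    Set.mem_iInter]
  simp only [SetLike.mem_coe, MulAction.mem_stabilizer_iff]
  constructor
  · intro h T
    have hT := congrArg Subtype.val (h T)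
    rwa [AddSubgroup.torsionBy.coe_smul] at hT
  · intro h T
    exact Subtype.ext (by rw [AddSubgroup.torsionBy.coe_smul]; exact h T)

/-- Hence an abstract `K` whose image `ψ(K) ⊆ L̄` IS the division field `L(E[n])` satisfies BOTH
containments in `Γ_L`-currency: `ker ρ̄_{E,n} ≤ ψ(K)`'s fixing group (`K ⊆ L(E[n])`) and `ψ(K)`'s
fixing group `≤ ker ρ̄_{E,n}` (`K ⊇ L(E[n])`). [cite: SilvermanAEC2009, VIII.§1] -/
theorem ker_le_and_le_ker_of_fieldRange_eq_divisionField [CharZero L] [W.IsElliptic] [NeZero n]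
    (hψ : ψ.fieldRange = W.divisionField n) :
    (W.galoisRepTorsion (n : ℤ)).ker ≤ ψ.fieldRange.fixingSubgroup ∧
      ψ.fieldRange.fixingSubgroup ≤ (W.galoisRepTorsion (n : ℤ)).ker := by
  rw [hψ, W.fixingSubgroup_divisionField_eq_ker n]
  exact ⟨le_rfl, le_rfl⟩

/-- **`E[n]` is rational over an abstract copy `K` of THE division field `L(E[n])`** (`ψ : K →ₐ[L] L̄`
with `ψ.fieldRange = L(E[n])`; `E` elliptic, `n ≠ 0`, `char L = 0`): `Gal(K̄/K)` fixes every point of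
`(W ⊗_L K)[n](K̄)`. [cite: SilvermanAEC2009, VIII.§1] [cite: MochizukiGenEll2010, Thm 3.8 p.20] -/
theorem forall_smul_geomTorsion_map_eq_of_fieldRange_eq_divisionField [CharZero L] [W.IsElliptic]
    [NeZero n] (hψ : ψ.fieldRange = W.divisionField n) :
    ∀ (σ' : Field.absoluteGaloisGroup K)
      (Q : (W.map (algebraMap L K)).geomTorsion (n : ℤ)), σ' • Q = Q :=
  W.forall_smul_geomTorsion_map_eq_of_fieldRange_fixingSubgroup_le n ψ
    (W.ker_le_and_le_ker_of_fieldRange_eq_divisionField n ψ hψ).2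

/-- **At THE division field itself**: `Gal(K̄/K)` for `K := L(E[n]) ⊆ L̄` (as a field in its own
right, `ψ` = the inclusion) fixes `(W ⊗_L K)[n](K̄)`. [cite: SilvermanAEC2009, VIII.§1] -/
theorem forall_smul_geomTorsion_map_divisionField_eq [CharZero L] [W.IsElliptic] [NeZero n] :
    ∀ (σ' : Field.absoluteGaloisGroup (W.divisionField n))
      (Q : (W.map (algebraMap L (W.divisionField n))).geomTorsion (n : ℤ)), σ' • Q = Q :=
  W.forall_smul_geomTorsion_map_eq_of_fieldRange_eq_divisionField n (W.divisionField n).val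
    (IntermediateField.fieldRange_val (S := W.divisionField n))

end WeierstrassCurve

end
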